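import Literature.NumberTheory.EllipticCurves.RibetTakahashiDefinitePrimeEisenstein
import Literature.NumberTheory.EllipticCurves.ModPIrreducibleCofinite
import Literature.NumberTheory.EllipticCurves.TakahashiDegreeFormulaCoprimeProofs
import HarnessLib

/-!
# `stub_takahashi` (crux stmt-ABC-11338 `DefiniteXi.DefiniteRTControlPrime`) — ideator k1, gen 19
# FAMILY 1 (recognise & import): the SIBLING-FACT match, typed and closed

Companion of `STUB-IDEAS-stub_takahashi-1.md` (gen 19).  The stub
`theorem stub_takahashi : takahashi2001_thm_2_3_of_coprime` is a reviewed NAMED FACT (Takahashi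
2001 Thm 2.3 at `r ∥ N`, cofactor `M` arbitrary).  Gens 2–18 (k1) typed the two-leaf split
`H_R` + `H_D'` ⟹ stub and the coprime component-group bridge `H_C` (all by reference, unchanged).

New here (gen 19), FAMILY 1 "tree match — does an existing declaration specialise to it?" run over
the NAMED FACTS of the tree rather than its theorems: the only other reviewed fact whose body contains
the stub's conclusion is the composite `takahashi2001_thm_2_3_2_7_of_coprime`
(`RibetTakahashiDefinitePrimeEisenstein.lean`, Thm 2.3 + Thm 2.7, binder `5 ≤ r` from Ribet 1990
Thm 3.12).  We type the prime-range restriction `TakahashiCoprimeOn Q` of the stub and PROVE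

* `on_ge_five_of_thm_2_3_2_7` : the composite fact gives the stub at every prime `r ≥ 5`
  (an irreducible residual prime `p` for `W` exists unconditionally:
  `WeierstrassCurve.exists_forall_hasIrreducibleModPGaloisRep_of_lt`, AEC IX.6.3, in tree);
* `stub_of_on_ge_five_of_on_lt_five` : stub ⟸ (range `5 ≤ r`) ∧ (range `r < 5`);
* `stub_iff_on_true` : the stub is the unrestricted range (sanity).

So the sibling fact does NOT retire the stub: the residual range `r ∈ {2, 3}` stays, and `r = 3` is
load-bearing for the crux (odd `q ∣ N`, `3 ∣ abc` happens) — door closed with a kernel witness of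
exactly what is and is not covered.  Nothing here asserts any named fact.
-/

set_option linter.dupNamespace false

noncomputable section

namespace Summit.ABC.ABC.Cruxes.DefiniteRTControlPrime.StubIdeas1G19

open scoped BigOperators
open Literature.NumberTheory.EllipticCurves Literature.NumberTheory.EllipticCurves.ModularForms
open Literature.NumberTheory.Automorphic

/-- The stub `takahashi2001_thm_2_3_of_coprime` restricted to primes `r` satisfying `Q r`
(verbatim body, one extra binder `Q r` after `r.Prime`). -/
def TakahashiCoprimeOn (Q : ℕ → Prop) : Prop :=
  ∀ (W : WeierstrassCurve ℚ) [W.IsElliptic] (M r : ℕ) [NeZero (M * r)],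
    r.Prime → Q r → M.Coprime r → W.conductorNorm ℤ = M * r →
    ∀ P : ModularParametrizationData W (M * r),
      (∀ (W' : WeierstrassCurve ℚ) [W'.IsElliptic], W'.conductorNorm ℤ = M * r →
          ∀ P' : ModularParametrizationData W' (M * r),
          P'.f = P.f → P.modularDegree ≤ P'.modularDegree) →
      ∀ S : Brandt.XiSetup M r,
        ∃ i j : ℕ, 0 < i ∧ i * j = (W.minimalDiscriminantNorm ℤ).factorization r ∧
          i ∣ S.xi (fun n => W.LFunction n) ∧
          P.modularDegree * i = S.xi (fun n => W.LFunction n) * j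

/-- Sanity: the stub is the unrestricted range. -/
theorem stub_iff_on_true :
    takahashi2001_thm_2_3_of_coprime ↔ TakahashiCoprimeOn fun _ => True :=
  ⟨fun h W _ M r _ hr _ hcop hN P hmin S => h W M r hr hcop hN P hmin S,
    fun h W _ M r _ hr hcop hN P hmin S => h W M r hr trivial hcop hN P hmin S⟩

/-- Monotonicity of the range predicate. -/
theorem TakahashiCoprimeOn.mono {Q Q' : ℕ → Prop} (hQ : ∀ r, Q' r → Q r)
    (h : TakahashiCoprimeOn Q) : TakahashiCoprimeOn Q' :=
  fun W _ M r _ hr hq hcop hN P hmin S => h W M r hr (hQ r hq) hcop hN P hmin S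

/-- **Sibling-fact match (FAMILY 1, gen 19).** The reviewed composite fact
`takahashi2001_thm_2_3_2_7_of_coprime` (Thm 2.3 + Thm 2.7, `5 ≤ r`) yields the stub's conclusion at
every prime `r ≥ 5`: pick any prime `p` beyond the finitely many reducible residual primes of `W`
(`exists_forall_hasIrreducibleModPGaloisRep_of_lt`) and drop the clause `¬ p ∣ i`
(`takahashi2001_thm_2_3_2_7_of_coprime.exists_of_prime`). PROVED. [cite: Takahashi2001, Thm. 2.3 (p. 79)] -/
theorem on_ge_five_of_thm_2_3_2_7 (h : takahashi2001_thm_2_3_2_7_of_coprime) :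
    TakahashiCoprimeOn fun r => 5 ≤ r := by
  intro W _ M r _ hr h5 hcop hN P hmin S
  obtain ⟨N₀, hN₀⟩ := W.exists_forall_hasIrreducibleModPGaloisRep_of_lt
  obtain ⟨p, hNp, hp⟩ := Nat.exists_infinite_primes (N₀ + 1)
  exact takahashi2001_thm_2_3_2_7_of_coprime.exists_of_prime h W M r hr h5 hcop hN P hmin S hp
    (hN₀ p (by omega) hp)

/-- **What the sibling leaves over**: the stub from the two ranges `5 ≤ r` and `r < 5` (the latter is
`r ∈ {2, 3}` for primes). PROVED (case split). -/
theorem stub_of_on_ge_five_of_on_lt_five (h₅ : TakahashiCoprimeOn fun r => 5 ≤ r)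
    (h₂₃ : TakahashiCoprimeOn fun r => r < 5) : takahashi2001_thm_2_3_of_coprime := by
  intro W _ M r _ hr hcop hN P hmin S
  rcases Nat.lt_or_ge r 5 with h | h
  · exact h₂₃ W M r hr h hcop hN P hmin S
  · exact h₅ W M r hr h hcop hN P hmin S

/-- Hence: composite sibling fact + the residual range `r < 5` ⟹ stub. PROVED; records that the
sibling does not retire the stub (the `r = 3` instances are load-bearing for the crux). -/
theorem stub_of_thm_2_3_2_7_of_on_lt_five (h : takahashi2001_thm_2_3_2_7_of_coprime)
    (h₂₃ : TakahashiCoprimeOn fun r => r < 5) : takahashi2001_thm_2_3_of_coprime :=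
  stub_of_on_ge_five_of_on_lt_five (on_ge_five_of_thm_2_3_2_7 h) h₂₃

/-- For primes, the residual range `r < 5` is exactly `r = 2 ∨ r = 3`. -/
theorem prime_lt_five_iff {r : ℕ} (hr : r.Prime) : r < 5 ↔ r = 2 ∨ r = 3 := by
  constructor
  · intro h
    interval_cases r <;> simp_all (config := {decide := true})
  · rintro (rfl | rfl) <;> omega

/-- The one-sided inequality the crux's certificate consumes (`δ ≤ ξ · ord_r Δ_min`, k3 "N1"),
on a range: immediate from the range-restricted stub (same three lines as the tree's
`takahashi2001_thm_2_3_of_coprime.modularDegree_le_xi_mul`). PROVED. -/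
theorem modularDegree_le_xi_mul_on {Q : ℕ → Prop} (h : TakahashiCoprimeOn Q)
    (W : WeierstrassCurve ℚ) [W.IsElliptic] (M r : ℕ) [NeZero (M * r)] (hr : r.Prime) (hq : Q r)
    (hcop : M.Coprime r) (hN : W.conductorNorm ℤ = M * r) (P : ModularParametrizationData W (M * r))
    (hmin : ∀ (W' : WeierstrassCurve ℚ) [W'.IsElliptic], W'.conductorNorm ℤ = M * r →
      ∀ P' : ModularParametrizationData W' (M * r), P'.f = P.f → P.modularDegree ≤ P'.modularDegree)
    (S : Brandt.XiSetup M r) :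
    P.modularDegree ≤
      S.xi (fun n => W.LFunction n) * (W.minimalDiscriminantNorm ℤ).factorization r := by
  obtain ⟨i, j, hi, hij, -, hδ⟩ := h W M r hr hq hcop hN P hmin S
  calc P.modularDegree ≤ P.modularDegree * i := Nat.le_mul_of_pos_right _ hi
    _ = S.xi (fun n => W.LFunction n) * j := hδ
    _ ≤ S.xi (fun n => W.LFunction n) * (i * j) :=
        Nat.mul_le_mul_left _ (Nat.le_mul_of_pos_left _ hi)
    _ = _ := by rw [hij]

end Summit.ABC.ABC.Cruxes.DefiniteRTControlPrime.StubIdeas1G19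

end
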